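import Summits.MatrixMultiplication.MatrixMultiplication.Theorems.SoloInformedNearRectPins

/-!
# THEOREM 8.20, Step 3.1 in threshold form: the column split, dirty-pair typing, at most two SAME-groups

This work, §8.8 (T12)(f) Step 3.1 and C3-m2 §5.4 (iv), §5.5 (gen 107). Setting as in `SoloInformedThirdRow`: equation
data `D : Data ι G` (no 2-torsion), a chart `Φ`, full separation, class map `κ : G → R` (`r = |R|`).

In the all-L world of THEOREM 8.20 the rows `i ∈ I₁` of `a` are `∼ α` on the poor family `Jp` off column sets `Ea i`
of size `≤ d`. The atoms of Step 3.1, each as BOUND ∨ STRUCTURE or as pure structure: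
* `Data.bcol_agree_of_crow_ne`: two such rows `i₀, i₀′` and a column `k` with `c(k,i₀) ≁ c(k,i₀′)` force column `k`
  of `b` to be class-constant on the common conforming set (the two-centre lemma `signEq_of_mem_inter₃`);
* `Data.col_split` (THE COLUMN SPLIT `K_c ∪ K_b`): every column `k` has row `k` of `c` class-constant on `I₁`, or
  column `k` of `b` class-constant on `Jp` off `≤ 2d` rows;
* `Data.dirty_pair_typed` (8.16c in threshold form): two columns `k, k′` with `b(·,k) ∼ β_k`, `b(·,k′) ∼ β_{k′}` on
  `Jp` off `≤ d₂` rows and rows `k, k′` of `c` pinned (`∼ U_k`, `∼ U_{k′}`) on `Is`: either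
  `n²·min(|Is|, t) ≤ 2·r·|S⁰|`, or the pair is SAME (`U_k ∼ U_{k′} ∧ β_k ∼ β_{k′}`) or CROSS
  (`U_k ∼ β_{k′} ∧ U_{k′} ∼ β_k`) [`Data.sq_mul_min_le_of_two_crows`];
* `same_groups` (§5.4 (iv)): a family in which every pair is SAME or CROSS contains a pairwise-SAME half.
-/

namespace Summit.MatrixMultiplication.MatrixMultiplication.Theorems.TwistedTPP

namespace FibreLines

variable {ι G : Type*} [AddCommGroup G]

/-- Two rows of `a` of the same class `α` on `Js` and a column `k` on which the two rows of `c` differ in class: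
column `k` of `b` is class-constant on `Js`. [this work, §8.8 (T12)(f) Step 3] -/
theorem Data.bcol_agree_of_crow_ne (hG : ∀ x : G, x = -x → x = 0) (D : Data ι G) {i₀ i₀' k : ι} {α : G}
    (Js : Finset ι) (hi : ∀ j ∈ Js, SignEq (D.a i₀ j) α) (hi' : ∀ j ∈ Js, SignEq (D.a i₀' j) α)
    (hne : ¬ SignEq (D.c k i₀) (D.c k i₀')) : ∀ j ∈ Js, ∀ j' ∈ Js, SignEq (D.b j' k) (D.b j k) := by
  intro j hj j' hj'
  have e1 : ∀ j ∈ Js, SignEq (D.b j k) (D.c k i₀ + α) ∨ SignEq (D.b j k) (D.c k i₀ - α) := fun j hj =>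
    ((D.adm_eqn i₀ j k).of_signEq_left (hi j hj)).rotate.rotate.signEq_add_or_sub
  have e2 : ∀ j ∈ Js, SignEq (D.b j k) (D.c k i₀' + α) ∨ SignEq (D.b j k) (D.c k i₀' - α) := fun j hj =>
    ((D.adm_eqn i₀' j k).of_signEq_left (hi' j hj)).rotate.rotate.signEq_add_or_sub
  exact signEq_of_mem_inter₃ hG (fun h => hne h.2) (fun h => hne (h.2.symm.trans h.1))
    (e1 j' hj') (e2 j' hj') (e1 j hj) (e2 j hj)

/-- **THE COLUMN SPLIT of Step 3.1.** Rows `i ∈ I₁` of `a` are `∼ α` on `Jp` off `Ea i` (`|Ea i| ≤ d`). Every column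
`k`: row `k` of `c` is class-constant on `I₁` (`k ∈ K_c`), or column `k` of `b` is class-constant on `Jp` off `≤ 2d`
rows (`k ∈ K_b`). [this work, §8.8 (T12)(f) Step 3.1; C3-m2 §5.5] -/
theorem Data.col_split [DecidableEq ι] (hG : ∀ x : G, x = -x → x = 0) (D : Data ι G) {α : G}
    (I₁ Jp : Finset ι) (d : ℕ) (Ea : ι → Finset ι)
    (hEa : ∀ i ∈ I₁, (Ea i).card ≤ d ∧ ∀ j ∈ Jp, j ∉ Ea i → SignEq (D.a i j) α) (k : ι) :
    (∀ i ∈ I₁, ∀ i' ∈ I₁, SignEq (D.c k i) (D.c k i')) ∨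
      ∃ E : Finset ι, E.card ≤ 2 * d ∧
        ∀ j ∈ Jp, j ∉ E → ∀ j' ∈ Jp, j' ∉ E → SignEq (D.b j' k) (D.b j k) := by
  by_cases h : ∀ i ∈ I₁, ∀ i' ∈ I₁, SignEq (D.c k i) (D.c k i')
  · exact Or.inl h
  right
  push Not at h
  obtain ⟨i, hi, i', hi', hne⟩ := h
  refine ⟨Ea i ∪ Ea i', (Finset.card_union_le _ _).trans (by
    have := (hEa i hi).1; have := (hEa i' hi').1; omega), fun j hj hjE j' hj' hj'E => ?_⟩
  have hJs : ∀ i'' ∈ ({i, i'} : Finset ι), ∀ j'' ∈ Jp \ (Ea i ∪ Ea i'), SignEq (D.a i'' j'') α := by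
    intro i'' hi'' j'' hj''
    obtain ⟨hj''p, hj''E⟩ := Finset.mem_sdiff.1 hj''
    rw [Finset.mem_union, not_or] at hj''E
    rcases Finset.mem_insert.1 hi'' with rfl | hi''
    · exact (hEa _ hi).2 j'' hj''p hj''E.1
    · rw [Finset.mem_singleton] at hi''; subst hi''
      exact (hEa _ hi').2 j'' hj''p hj''E.2
  exact D.bcol_agree_of_crow_ne hG (Jp \ (Ea i ∪ Ea i'))
    (hJs i (Finset.mem_insert_self _ _)) (hJs i' (Finset.mem_insert_of_mem (Finset.mem_singleton_self _)))
    hne j (Finset.mem_sdiff.2 ⟨hj, hjE⟩) j' (Finset.mem_sdiff.2 ⟨hj', hj'E⟩)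

variable {G₀ : Type*} [AddCommGroup G₀] {R : Type*}

/-- **8.16c IN THRESHOLD FORM (dirty-pair typing).** [this work, §8.8 (T12)(f) Step 3.1; C3-m2 §5.5] -/
theorem Data.dirty_pair_typed [Fintype ι] [DecidableEq ι] [Fintype G₀] [DecidableEq G₀] [Fintype R]
    [DecidableEq R] (hG : ∀ x : G, x = -x → x = 0) (D : Data ι G) (Φ : Chart ι G₀) (κ : G → R)
    (hκ : ∀ x y, κ x = κ y → SignEq x y) (hsep : D.SepAll Φ) {k k' : ι} {U U' β β' : G}
    (Is Jp Eb Eb' : Finset ι) (d₂ t : ℕ) (hEb : Eb.card ≤ d₂) (hEb' : Eb'.card ≤ d₂)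
    (hbk : ∀ j ∈ Jp, j ∉ Eb → SignEq (D.b j k) β) (hbk' : ∀ j ∈ Jp, j ∉ Eb' → SignEq (D.b j k') β')
    (hck : ∀ i ∈ Is, SignEq (D.c k i) U) (hck' : ∀ i ∈ Is, SignEq (D.c k' i) U')
    (hJp : 2 * t + 2 * d₂ < Jp.card) :
    Fintype.card ι ^ 2 * min Is.card t ≤ 2 * (Fintype.card R * Fintype.card G₀) ∨
      (SignEq U U' ∧ SignEq β β') ∨ (SignEq U β' ∧ SignEq U' β) := by
  classical
  set J' : Finset ι := Jp.filter fun j =>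
    ¬ (SignEq U U' ∧ SignEq (D.b j k) (D.b j k')) ∧ ¬ (SignEq U (D.b j k') ∧ SignEq U' (D.b j k)) with hJ'
  have hb := D.sq_mul_min_le_of_two_crows hG Φ κ hκ hsep Is J' hck hck'
    (fun j hj => (Finset.mem_filter.1 hj).2.1) (fun j hj => (Finset.mem_filter.1 hj).2.2)
  by_cases ht : t ≤ J'.card / 2
  · left
    exact le_trans (Nat.mul_le_mul_left _ (min_le_min_left _ ht)) hb
  · right
    push Not at ht
    have hlt : (J' ∪ Eb ∪ Eb').card < Jp.card := by
      have h1 := Finset.card_union_le (J' ∪ Eb) Eb'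
      have h2 := Finset.card_union_le J' Eb
      omega
    obtain ⟨j, hj, hjn⟩ := Finset.exists_mem_notMem_of_card_lt_card hlt
    simp only [Finset.mem_union, not_or] at hjn
    obtain ⟨⟨hjJ', hjEb⟩, hjEb'⟩ := hjn
    have h1 := hbk j hj hjEb
    have h2 := hbk' j hj hjEb'
    have : ¬ (¬ (SignEq U U' ∧ SignEq (D.b j k) (D.b j k')) ∧ ¬ (SignEq U (D.b j k') ∧ SignEq U' (D.b j k))) :=
      fun h => hjJ' (Finset.mem_filter.2 ⟨hj, h⟩)
    rw [not_and_or, not_not, not_not] at this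
    rcases this with h | h
    · exact Or.inl ⟨h.1, h1.symm.trans (h.2.trans h2)⟩
    · exact Or.inr ⟨h.1.trans h2, h.2.trans h1⟩

/-- **AT MOST TWO SAME-GROUPS (§5.4 (iv)).** If every pair of a family is SAME or CROSS, a half of the family is
pairwise SAME (two CROSS partners of a fixed member are SAME with each other). [this work, C3-m2 §5.5] -/
theorem same_groups [DecidableEq ι] (β U : ι → G) (Kd : Finset ι)
    (h : ∀ k ∈ Kd, ∀ k' ∈ Kd,
      (SignEq (U k) (U k') ∧ SignEq (β k) (β k')) ∨ (SignEq (U k) (β k') ∧ SignEq (U k') (β k))) :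
    ∃ Kg ⊆ Kd, Kd.card ≤ 2 * Kg.card ∧
      ∀ k ∈ Kg, ∀ k' ∈ Kg, SignEq (β k) (β k') ∧ SignEq (U k) (U k') := by
  classical
  rcases Kd.eq_empty_or_nonempty with h0 | ⟨k₀, hk₀⟩
  · exact ⟨∅, Finset.empty_subset _, by simp [h0], by simp⟩
  set S : Finset ι := Kd.filter fun k => SignEq (U k₀) (U k) ∧ SignEq (β k₀) (β k) with hS
  set C : Finset ι := Kd.filter fun k => SignEq (U k₀) (β k) ∧ SignEq (U k) (β k₀) with hC
  have hcover : Kd ⊆ S ∪ C := by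
    intro k hk
    rcases h k₀ hk₀ k hk with hh | hh
    · exact Finset.mem_union_left _ (Finset.mem_filter.2 ⟨hk, hh⟩)
    · exact Finset.mem_union_right _ (Finset.mem_filter.2 ⟨hk, hh⟩)
  have hcard : Kd.card ≤ S.card + C.card :=
    (Finset.card_le_card hcover).trans (Finset.card_union_le _ _)
  by_cases hS2 : Kd.card ≤ 2 * S.card
  · refine ⟨S, Finset.filter_subset _ _, hS2, fun k hk k' hk' => ?_⟩
    obtain ⟨hu, hb⟩ := (Finset.mem_filter.1 hk).2
    obtain ⟨hu', hb'⟩ := (Finset.mem_filter.1 hk').2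
    exact ⟨hb.symm.trans hb', hu.symm.trans hu'⟩
  · refine ⟨C, Finset.filter_subset _ _, by omega, fun k hk k' hk' => ?_⟩
    obtain ⟨hu, hb⟩ := (Finset.mem_filter.1 hk).2
    obtain ⟨hu', hb'⟩ := (Finset.mem_filter.1 hk').2
    exact ⟨hu.symm.trans hu', hb.trans hb'.symm⟩

end FibreLines

end Summit.MatrixMultiplication.MatrixMultiplication.Theorems.TwistedTPP
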